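import Summits.AtomisticToContinuum.Crystallization.Theorems.FrustratedLawDichotomyStrainedPatchHomLeafBridgeHcp
import Summits.AtomisticToContinuum.Crystallization.Theorems.FrustratedLawDichotomyStrainedPatchHomLeafCheckW

/-!
# The reflected (P4) hcp GRAM-LEAF CHECKER (computable): `termsOKH / sumVH / sumGH / sumCH` and `leaf_soundH`

decomp-a2c hand-2 g21 (crux `AperiodicFrustratedLawGap`, stmt-AtomisticToContinuum-27623).  hcp twin of `…HomLeafCheckW` over the bridge
`…HomLeafBridgeHcp.boxSumHcp_ge_of_termChecks2`: extended Gram coordinates `κ = (Fin 3 × Fin 3) ⊕ (Fin 3 ⊕ Fin 1)` (scaled integers `c0`, half-widths `w`),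
labels `box7 ⊕ box7full` (unshifted family over `[−7,7]³ ∖ 0`, shifted family over `[−7,7]³`), INTEGER functionals `LzH`, the SAME per-term hint generators
`curvM2 / valLo2 / derivLo2 / derivHi2` and v2 checks as the fcc file (the potential is the same W₄₅), signed gradient, outward-rounded aggregates, all over the
COMPUTABLE boxes (`boxC`, `boxCfull`).  ★★★ `leaf_soundH`: the four kernel/native facts + the literal comparison ⟹
`μ/SC ≤ Σ_{b∈box7} W₄₅‖latPt U f b‖ + Σ_{b∈[−7,7]³} W₄₅‖latPt U f b + U t‖` for every `U, t` with extended Gram data in the box (any frame `f`, shift `t`; the cover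
theorem's hcp leaf uses `f = hexFrame`, `t = hcpShift + ξ`).  0 sorry; standard axioms.  `--supports stmt-AtomisticToContinuum-27623`.
-/

namespace Summit.AtomisticToContinuum.Crystallization.Theorems.FrustratedLawDichotomyStrainedPatchHomLeafCheckHcp

open scoped BigOperators RealInnerProductSpace
open Literature.Analysis.ValidatedNumerics.Numerics
open Summit.AtomisticToContinuum.Crystallization.Theorems.ChargedEnergyGapNegative (E3)
open Summit.AtomisticToContinuum.Crystallization.Theorems.FrustratedLawDichotomySchurCut (effPot w₄₅ ω₄)
open Summit.AtomisticToContinuum.Crystallization.Theorems.FrustratedLawDichotomyStrainedPatchHomSplit (latPt)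
open Summit.AtomisticToContinuum.Crystallization.Theorems.FrustratedLawDichotomyStrainedPatchHomTermEvalW
open Summit.AtomisticToContinuum.Crystallization.Theorems.FrustratedLawDichotomyStrainedPatchHomLeafBridgeHcp (boxSumHcp_ge_of_termChecks2)
open Summit.AtomisticToContinuum.Crystallization.Theorems.FrustratedLawDichotomyStrainedPatchHomLeafCheck (box7)
open Summit.AtomisticToContinuum.Crystallization.Theorems.FrustratedLawDichotomyStrainedPatchHomLeafCheckC (iccC iccC_eq boxC boxC_eq)
open Summit.AtomisticToContinuum.Crystallization.Theorems.FrustratedLawDichotomyStrainedPatchHomLeafCheckW (curvM2 valLo2 derivLo2 derivHi2)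

/-! ## §1. Labels, coordinates, integer functionals -/

/-- The full computable label box `[−7,7]³` (shifted family; includes `0`). -/
def boxCfull : Finset (Fin 3 → ℤ) := Fintype.piFinset fun _ : Fin 3 => iccC

/-- `boxCfull` is the literal box of the cover theorem. [formal bookkeeping] -/
theorem boxCfull_eq : boxCfull = Fintype.piFinset fun _ : Fin 3 => Finset.Icc (-7 : ℤ) 7 := by
  unfold boxCfull; rw [iccC_eq]

/-- The integer extended functional: `bᵢbⱼ | 0 | 0` (unshifted) and `bᵢbⱼ | 2bᵢ | 1` (shifted). -/
def LzH : (Fin 3 → ℤ) ⊕ (Fin 3 → ℤ) → (Fin 3 × Fin 3) ⊕ (Fin 3 ⊕ Fin 1) → ℤ :=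
  Sum.elim (fun b => Sum.elim (fun ij : Fin 3 × Fin 3 => b ij.1 * b ij.2) (fun _ => (0 : ℤ)))
    (fun b => Sum.elim (fun ij : Fin 3 × Fin 3 => b ij.1 * b ij.2) (Sum.elim (fun i : Fin 3 => 2 * b i) (fun _ => (1 : ℤ))))

/-- Scaled centre of a term's squared-length range. -/
def q0H (c0 : (Fin 3 × Fin 3) ⊕ (Fin 3 ⊕ Fin 1) → ℤ) (v : (Fin 3 → ℤ) ⊕ (Fin 3 → ℤ)) : ℤ := ∑ k, LzH v k * c0 k

/-- Scaled radius of a term's squared-length range. -/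
def rH (w : (Fin 3 × Fin 3) ⊕ (Fin 3 ⊕ Fin 1) → ℤ) (v : (Fin 3 → ℤ) ⊕ (Fin 3 → ℤ)) : ℤ := ∑ k, |LzH v k| * w k

/-- The computable label set of both families. -/
def labelsH : Finset ((Fin 3 → ℤ) ⊕ (Fin 3 → ℤ)) := boxC.disjSum boxCfull

/-! ## §2. The checks and aggregates -/

/-- Per-term part: half-widths non-negative and the three v2 term checks on the generated hints, for every label of both families. -/
def termsOKH (c0 w : (Fin 3 × Fin 3) ⊕ (Fin 3 ⊕ Fin 1) → ℤ) : Bool :=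
  decide (∀ k, 0 ≤ w k) &&
  decide (∀ v ∈ labelsH,
    curvOK2 (q0H c0 v - rH w v) (q0H c0 v + rH w v) (curvM2 (q0H c0 v - rH w v) (q0H c0 v + rH w v)) = true ∧
    valLoOK2 (q0H c0 v) (valLo2 (q0H c0 v)) = true ∧
    derivOK2 (q0H c0 v) (derivLo2 (q0H c0 v)) (derivHi2 (q0H c0 v)) = true)

/-- Signed gradient bound per coordinate. -/
def gradAH (c0 : (Fin 3 × Fin 3) ⊕ (Fin 3 ⊕ Fin 1) → ℤ) (k : (Fin 3 × Fin 3) ⊕ (Fin 3 ⊕ Fin 1)) : ℤ :=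
  max |∑ v ∈ labelsH, min (derivLo2 (q0H c0 v) * LzH v k) (derivHi2 (q0H c0 v) * LzH v k)|
    |∑ v ∈ labelsH, max (derivLo2 (q0H c0 v) * LzH v k) (derivHi2 (q0H c0 v) * LzH v k)|

/-- Aggregate 1: `Σ_v valLo`. -/
def sumVH (c0 : (Fin 3 × Fin 3) ⊕ (Fin 3 ⊕ Fin 1) → ℤ) : ℤ := ∑ v ∈ labelsH, valLo2 (q0H c0 v)

/-- Aggregate 2: `Σₖ ⌈gradAH k · wₖ / SC⌉`. -/
def sumGH (c0 w : (Fin 3 × Fin 3) ⊕ (Fin 3 ⊕ Fin 1) → ℤ) : ℤ := ∑ k, cdiv (gradAH c0 k * w k) SC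

/-- Aggregate 3: `⌈Σ_v curvM_v · r_v² / (2·SC²)⌉`. -/
def sumCH (c0 w : (Fin 3 × Fin 3) ⊕ (Fin 3 ⊕ Fin 1) → ℤ) : ℤ :=
  cdiv (∑ v ∈ labelsH, curvM2 (q0H c0 v - rH w v) (q0H c0 v + rH w v) * rH w v ^ 2) (2 * (SC : ℤ) * SC)

/-! ## §3. Soundness -/

/-- ★★★ **SOUNDNESS OF THE hcp LEAF CHECK** (shape of `…HomLeafCheckW.leaf_sound2`). [folklore] -/
theorem leaf_soundH {c0 w : (Fin 3 × Fin 3) ⊕ (Fin 3 ⊕ Fin 1) → ℤ} {μ s₁ s₂ s₃ : ℤ} (h : termsOKH c0 w = true) (e₁ : sumVH c0 = s₁)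
    (e₂ : sumGH c0 w = s₂) (e₃ : sumCH c0 w = s₃) (hineq : μ ≤ s₁ - s₂ - s₃) (f : Fin 3 → E3) (U : E3 →L[ℝ] E3) (t : E3)
    (hbox : ∀ k, |(Sum.elim (fun ij : Fin 3 × Fin 3 => ⟪U (f ij.1), U (f ij.2)⟫)
      (Sum.elim (fun i : Fin 3 => ⟪U (f i), U t⟫) (fun _ => ‖U t‖ ^ 2)) k) - (c0 k : ℝ) / SC| ≤ (w k : ℝ) / SC) :
    (μ : ℝ) / SC ≤ ∑ b ∈ (Fintype.piFinset fun _ : Fin 3 => Finset.Icc (-7 : ℤ) 7).filter (fun b => b ≠ 0), effPot w₄₅ ω₄ (3 / 400) ‖latPt U f b‖ +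
      ∑ b ∈ (Fintype.piFinset fun _ : Fin 3 => Finset.Icc (-7 : ℤ) 7), effPot w₄₅ ω₄ (3 / 400) ‖latPt U f b + U t‖ := by
  subst e₁ e₂ e₃
  have hlab : labelsH = ((Fintype.piFinset fun _ : Fin 3 => Finset.Icc (-7 : ℤ) 7).filter (fun b => b ≠ 0)).disjSum
      (Fintype.piFinset fun _ : Fin 3 => Finset.Icc (-7 : ℤ) 7) := by
    unfold labelsH; rw [boxC_eq, boxCfull_eq]; rfl
  unfold termsOKH at h
  rw [hlab] at h
  simp only [Bool.and_eq_true, decide_eq_true_eq] at h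
  obtain ⟨hw, hterms⟩ := h
  have hS := SC_pos
  have hS2 : (0:ℤ) < 2 * (SC : ℤ) * SC := mul_pos (mul_pos two_pos SCZ_pos) SCZ_pos
  refine boxSumHcp_ge_of_termChecks2 _ _ f c0 w (fun v => curvM2 (q0H c0 v - rH w v) (q0H c0 v + rH w v)) (fun v => valLo2 (q0H c0 v))
    (fun v => derivLo2 (q0H c0 v)) (fun v => derivHi2 (q0H c0 v)) μ hw LzH rfl (fun v hv => (hterms v hv).1) (fun v hv => (hterms v hv).2.1)
    (fun v hv => (hterms v hv).2.2) ?_ U t hbox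
  set Lab := ((Fintype.piFinset fun _ : Fin 3 => Finset.Icc (-7 : ℤ) 7).filter (fun b => b ≠ 0)).disjSum
      (Fintype.piFinset fun _ : Fin 3 => Finset.Icc (-7 : ℤ) 7) with hLab
  have hI : (μ : ℝ) ≤ ((∑ v ∈ Lab, valLo2 (q0H c0 v) : ℤ) : ℝ) - ((∑ k, cdiv (gradAH c0 k * w k) SC : ℤ) : ℝ) -
      ((cdiv (∑ v ∈ Lab, curvM2 (q0H c0 v - rH w v) (q0H c0 v + rH w v) * rH w v ^ 2) (2 * (SC : ℤ) * SC) : ℤ) : ℝ) := by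
    unfold sumVH sumGH sumCH at hineq; rw [hlab] at hineq; exact_mod_cast hineq
  -- piece 2 (signed gradient)
  have hL : ∀ (D : ℤ) (v : (Fin 3 → ℤ) ⊕ (Fin 3 → ℤ)) (k : (Fin 3 × Fin 3) ⊕ (Fin 3 ⊕ Fin 1)),
      ((D : ℝ) / SC) * ((LzH v k : ℤ) : ℝ) = ((D * LzH v k : ℤ) : ℝ) / SC := by
    intro D v k; push_cast; ring
  have h2 : ∑ k, max (|∑ v ∈ Lab, min (((derivLo2 (q0H c0 v) : ℝ) / SC) * (LzH v k : ℝ)) (((derivHi2 (q0H c0 v) : ℝ) / SC) * (LzH v k : ℝ))|)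
      (|∑ v ∈ Lab, max (((derivLo2 (q0H c0 v) : ℝ) / SC) * (LzH v k : ℝ)) (((derivHi2 (q0H c0 v) : ℝ) / SC) * (LzH v k : ℝ))|) * ((w k : ℝ) / SC) ≤
      ((∑ k, cdiv (gradAH c0 k * w k) SC : ℤ) : ℝ) / SC := by
    rw [Int.cast_sum, Finset.sum_div]
    refine Finset.sum_le_sum fun k _ => ?_
    have hA : max (|∑ v ∈ Lab, min (((derivLo2 (q0H c0 v) : ℝ) / SC) * (LzH v k : ℝ)) (((derivHi2 (q0H c0 v) : ℝ) / SC) * (LzH v k : ℝ))|)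
        (|∑ v ∈ Lab, max (((derivLo2 (q0H c0 v) : ℝ) / SC) * (LzH v k : ℝ)) (((derivHi2 (q0H c0 v) : ℝ) / SC) * (LzH v k : ℝ))|) =
        ((gradAH c0 k : ℤ) : ℝ) / SC := by
      simp only [hL, min_div_div_right SC_pos.le, max_div_div_right SC_pos.le, ← Finset.sum_div, abs_div, abs_of_pos hS]
      unfold gradAH; rw [hlab]; push_cast; rfl
    rw [hA]
    have := div_le_cdiv (a := gradAH c0 k * w k) (b := (SC : ℤ)) (by exact_mod_cast SCZ_pos)
    push_cast at this
    calc ((gradAH c0 k : ℤ) : ℝ) / SC * ((w k : ℝ) / SC) = ((gradAH c0 k : ℝ) * (w k) / SC) / SC := by field_simp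
      _ ≤ ((cdiv (gradAH c0 k * w k) SC : ℤ) : ℝ) / SC := div_le_div_of_nonneg_right this hS.le
  -- piece 3 (curvature)
  have h3 : 1 / 2 * ∑ v ∈ Lab, ((curvM2 (q0H c0 v - rH w v) (q0H c0 v + rH w v) : ℝ) / SC) *
        (∑ k, |((LzH v k : ℤ) : ℝ)| * ((w k : ℝ) / SC)) ^ 2 ≤
      ((cdiv (∑ v ∈ Lab, curvM2 (q0H c0 v - rH w v) (q0H c0 v + rH w v) * rH w v ^ 2) (2 * (SC : ℤ) * SC) : ℤ) : ℝ) / SC := by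
    have hr : ∀ v, ∑ k, |((LzH v k : ℤ) : ℝ)| * ((w k : ℝ) / SC) = ((rH w v : ℤ) : ℝ) / SC := by
      intro v; unfold rH; push_cast; rw [Finset.sum_div]; exact Finset.sum_congr rfl fun k _ => by ring
    simp only [hr]
    have := div_le_cdiv (a := ∑ v ∈ Lab, curvM2 (q0H c0 v - rH w v) (q0H c0 v + rH w v) * rH w v ^ 2) (b := 2 * (SC : ℤ) * SC) hS2
    have e : 1 / 2 * ∑ v ∈ Lab, ((curvM2 (q0H c0 v - rH w v) (q0H c0 v + rH w v) : ℝ) / SC) * (((rH w v : ℤ) : ℝ) / SC) ^ 2 =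
        (((∑ v ∈ Lab, curvM2 (q0H c0 v - rH w v) (q0H c0 v + rH w v) * rH w v ^ 2 : ℤ) : ℝ) / ((2 * (SC : ℤ) * SC : ℤ) : ℝ)) / SC := by
      push_cast
      rw [Finset.mul_sum, Finset.sum_div, Finset.sum_div]
      refine Finset.sum_congr rfl fun v _ => ?_
      field_simp
    rw [e]
    exact div_le_div_of_nonneg_right this hS.le
  have h1 : ∑ v ∈ Lab, ((valLo2 (q0H c0 v) : ℝ)) / SC = ((∑ v ∈ Lab, valLo2 (q0H c0 v) : ℤ) : ℝ) / SC := by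
    rw [Int.cast_sum, Finset.sum_div]
  have hI' := div_le_div_of_nonneg_right hI hS.le
  rw [sub_div, sub_div] at hI'
  linarith [h1, h2, h3, hI']

end Summit.AtomisticToContinuum.Crystallization.Theorems.FrustratedLawDichotomyStrainedPatchHomLeafCheckHcp
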